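import Mathlib
import Summits.ValiantsHypothesis.ValiantsHypothesis.Theses.RefutationDegree
import Summits.ValiantsHypothesis.ValiantsHypothesis.Theses.GCTMult
import Literature.Computability.Complexity.HermitianSosRefutation
import Literature.Computability.Complexity.NullstellensatzRefutation
import Literature.Computability.AlgebraicComplexity.OrbitClosureProofs
import Literature.RingTheory.IntegralClosure.BrianconSkoda
import Literature.RingTheory.Nullstellensatz.SkodaBrownawellDegreeBound
import Summits.ValiantsHypothesis.ValiantsHypothesis.Theorems.RefutationDegreeCertWindowQPNsSmall
import Summits.ValiantsHypothesis.ValiantsHypothesis.Theorems.RefutationDegreeCertWindowQPDegArith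
import Summits.ValiantsHypothesis.ValiantsHypothesis.Theorems.RefutationDegreeCertWindowQPCoeffDegree
import Summits.ValiantsHypothesis.ValiantsHypothesis.Theorems.RefutationDegreeCertWindowQPCoeffHomog
import Summits.ValiantsHypothesis.ValiantsHypothesis.Theorems.RefutationDegreeCertWindowQPPullback
import Summits.ValiantsHypothesis.ValiantsHypothesis.Theorems.RefutationDegreeCertWindowQPHomogSelect
import Summits.ValiantsHypothesis.ValiantsHypothesis.Theorems.RefutationDegreeCertWindowQPIntegralRel
import Summits.ValiantsHypothesis.ValiantsHypothesis.Theorems.RefutationDegreeCertWindowQPNsOfPowMem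
import Summits.ValiantsHypothesis.ValiantsHypothesis.Theorems.RefutationDegreeCertWindowQPLojZero
import Summits.ValiantsHypothesis.ValiantsHypothesis.Theorems.RefutationDegreeNsToSos

/-!
# Crux `CertWindowQP` (stmt-ValiantsHypothesis-5640): closing compositions of line `Sketch`

`RefutationDegree.CertWindowQP` — "∃ c' ∀ c ∃ n ∀ m ≤ 2^((log₂ n + c)^c), the
determinantal-representability system `Rep(n,m)` (`per_n = det (A₀ + ∑ x_e A_e)` coefficientwise,
unknowns the `N = (n²+1)m²` matrix entries) has a Hermitian-SOS refutation with all products of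
degree `≤ (m+2)^{c'}`" — is conjecture-grade (with the proved soundness item `SosSound` it implies
that `n ↦ dc(per_n)` is not quasi-polynomially bounded). This file closes it, with `c' = 5`, MODULO
two named inputs, in two independent ways (**conditional results**):

* `CertWindowQP_of_brianconSkoda` — from `GCTMult.GctThesis` (item stmt-ValiantsHypothesis-0323:
  the padded permanent is off `Δ[det_m]` throughout the quasi-polynomial window) and the
  **Briançon–Skoda theorem for polynomial rings**
  (`Literature.RingTheory.IntegralClosure.brianconSkodaPolynomialRing`; Lipman–Sathaye,
  Huneke–Swanson Cor. 13.3.4), by pure commutative algebra: a separating test polynomial of the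
  Zariski-closed `Δ[det_m]`, pulled back along the constant-coefficient homogenisation map, is a
  polynomial identity `q(coeff_• det(A₀ + ∑ x_e A_e)) ≡ 0` with `q(coeff per_n) ≠ 0`
  (`stub_pullback`); the coefficients being homogeneous of degree `m` in the unknowns
  (`stub_coeffHomog`), a homogeneous component `F` of `q` does the same (`stub_homogSelect`);
  `Φ(Y,T) = F(Y + cT)` is an equation of integral dependence of `T^m` over the homogenised equations
  `G_μ = P_μ - c_μ T^m` (`stub_integralRel`); Briançon–Skoda gives `T^{m(N+1)} ∈ (G_μ)`, and
  homogeneous components plus `T = 1` give a Nullstellensatz refutation with all products of degree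
  `≤ (N+1)·m` (`stub_nsOfPowMem`) `≤ (m+2)^5` (`stub_degArith`).
* `CertWindowQP_of_skodaBrownawell` — from `GctThesis` and the ANALYTIC **Skoda–Brownawell degree
  bound** (`Literature.RingTheory.Nullstellensatz.skodaBrownawellDegreeBound`; Skoda 1972 + Liouville):
  off the border the fibre system has Łojasiewicz exponent `0` at infinity (`stub_lojZero`, a limit
  argument), its axioms have degree `≤ m` (`stub_coeffDegree`), and the bound gives a Nullstellensatz
  refutation of degree `≤ (N+1)·m`.

In both: `m < n` has a degree-`0` refutation (`stub_nsSmall`); NS ⇒ Hermitian SOS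
(`HasNSRefutationOfDegree.hasHermitianSosRefutationOfDegree`); the route's inlined `let`-form is
`exists_sos_certificate_support_of_hasHermitianSosRefutationOfDegree_coeff` (`Theorems/RefutationDegreeNsToSos.lean`).
All `stub_*` inputs are landed helper files `Theorems/RefutationDegreeCertWindowQP*.lean` of this line.
-/

open scoped BigOperators
open MvPolynomial

namespace Summit.ValiantsHypothesis.ValiantsHypothesis.Theorems

open Literature.Computability.AlgebraicComplexity Literature.Computability.Complexity
open Summit.ValiantsHypothesis.ValiantsHypothesis.Theses
open Literature.RingTheory.IntegralClosure (brianconSkodaPolynomialRing)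
open Literature.RingTheory.Nullstellensatz (skodaBrownawellDegreeBound)

-- `<Problem> = <Summit>` duplicates a namespace component by design (D-0017); the lakefile turns this linter off tree-wide.
set_option linter.dupNamespace false

/-- **The window statement in the Literature vocabulary, algebraic version.** From the
Briançon–Skoda theorem for polynomial rings and `GctThesis`: for every `c` there is an `n` such
that for all `m ≤ 2^((log₂ n + c)^c)` the fibre system `Rep(n,m)` (axioms: the `x`-coefficients of
`det (A₀ + ∑ x_e A_e) - per_n`) has a NULLSTELLENSATZ refutation with all products of degree
`≤ (m+2)^5`. Take `n := max n₀ 1` (`n₀` from `GctThesis` at `c`); `m < n`: `stub_nsSmall`; `n ≤ m`: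
separating polynomial → pullback (`stub_pullback`) → homogeneous component (`stub_coeffHomog`,
`stub_homogSelect`) → integral relation (`stub_integralRel`) → Briançon–Skoda (`hBS`) →
dehomogenisation (`stub_nsOfPowMem`) → `stub_degArith`. CONDITIONAL on the named fact
`brianconSkodaPolynomialRing` (hypothesis `hBS`) and on `GCTMult.GctThesis` (item
stmt-ValiantsHypothesis-0323, hypothesis `hG`). -/
theorem certWindowQP_hasNS_of_brianconSkoda (hBS : brianconSkodaPolynomialRing)
    (hG : GCTMult.GctThesis) (c : ℕ) :
    ∃ n : ℕ, ∀ m ≤ 2 ^ ((Nat.log 2 n + c) ^ c),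
      HasNSRefutationOfDegree (fun μ : (Fin n × Fin n) →₀ ℕ => ((Matrix.of fun i j : Fin m => MvPolynomial.C (MvPolynomial.X (none, (i, j))) + ∑ e : Fin n × Fin n, MvPolynomial.X e * MvPolynomial.C (MvPolynomial.X (some e, (i, j))) : Matrix (Fin m) (Fin m) (MvPolynomial (Fin n × Fin n) (MvPolynomial (Option (Fin n × Fin n) × (Fin m × Fin m)) ℂ))).det - MvPolynomial.map MvPolynomial.C (Literature.Computability.AlgebraicComplexity.perPoly (Fin n) ℂ)).coeff μ) ((m + 2) ^ 5) := by
  classical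
  obtain ⟨n₀, hn₀⟩ := hG c
  obtain ⟨n, hn₀n, h1n⟩ : ∃ n : ℕ, n₀ ≤ n ∧ 1 ≤ n := ⟨max n₀ 1, le_max_left _ _, le_max_right _ _⟩
  refine ⟨n, fun m hm => ?_⟩
  by_cases hlt : m < n
  · exact (stub_nsSmall n m hlt).mono (Nat.zero_le _)
  · push Not at hlt
    haveI : NeZero m := ⟨by omega⟩
    have hpad := hn₀ n hn₀n m hlt hm
    have hhom := stub_coeffHomog n m
    obtain ⟨q, hq0, hqP⟩ := stub_pullback n m hlt hpad
    obtain ⟨i, F, hF, hF0, hFP⟩ := stub_homogSelect n m q hhom hq0 hqP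
    obtain ⟨Φ, hΦ, hΦ0, hΦG⟩ := stub_integralRel n m i F hF hF0 hFP
    have hmem := hBS ℂ (Option (Option (Fin n × Fin n) × (Fin m × Fin m)))
      ((Fin n × Fin n) →₀ ℕ) _ _ i Φ hΦ hΦ0 hΦG
    have hns := stub_nsOfPowMem n m hhom hmem
    exact hns.mono (by simpa using stub_degArith n m hlt)

/-- **Line `Sketch` v2 (crux stmt-ValiantsHypothesis-5640), closing composition:
`GctThesis ⇒ CertWindowQP` modulo the Briançon–Skoda theorem for polynomial rings**, with
`c' = 5`: `certWindowQP_hasNS_of_brianconSkoda`, NS ⇒ Hermitian SOS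
(`HasNSRefutationOfDegree.hasHermitianSosRefutationOfDegree`), rewritten in the route's inlined
Hermitian-SOS form by `exists_sos_certificate_support_of_hasHermitianSosRefutationOfDegree_coeff`.
CONDITIONAL on the named fact `brianconSkodaPolynomialRing` (hypothesis `hBS`; Literature debt:
Lipman–Sathaye 1981 / Huneke–Swanson Cor. 13.3.4) and on `GCTMult.GctThesis` (item
stmt-ValiantsHypothesis-0323, hypothesis `hG`); the crux is thereby closed MODULO these two inputs. -/
theorem CertWindowQP_of_brianconSkoda (hBS : brianconSkodaPolynomialRing)
    (hG : GCTMult.GctThesis) : RefutationDegree.CertWindowQP := by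
  refine ⟨5, fun c => ?_⟩
  obtain ⟨n, hn⟩ := certWindowQP_hasNS_of_brianconSkoda hBS hG c
  exact ⟨n, fun m hm =>
    exists_sos_certificate_support_of_hasHermitianSosRefutationOfDegree_coeff _ ((m + 2) ^ 5)
      (hn m hm).hasHermitianSosRefutationOfDegree⟩

/-- **The window statement in the Literature vocabulary, analytic version**
(`HasHermitianSosRefutationOfDegree`): from the Skoda–Brownawell degree bound and `GctThesis`, for every `c` there is an `n` such that for
all `m ≤ 2^((log₂ n + c)^c)` the fibre system `Rep(n,m)` (axioms: the `x`-coefficients of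
`det (A₀ + ∑ x_e A_e) - per_n`) has a Hermitian-SOS refutation with all products of degree
`≤ (m+2)^5`. Take `n := max n₀ 1` with `n₀` from `GctThesis` at `c`; for `m < n` use the degree-`0`
Nullstellensatz refutation `stub_nsSmall`; for `n ≤ m` the padded permanent is off `Δ[det_m]`, so
`stub_lojZero` gives Łojasiewicz exponent `0` at infinity, the Skoda–Brownawell bound (with the axiom
degree bound `stub_coeffDegree`) gives a Nullstellensatz refutation of degree `≤ (N+1)·m ≤ (m+2)^5`
(`stub_degArith`), and `HasNSRefutationOfDegree.hasHermitianSosRefutationOfDegree` makes it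
Hermitian-SOS. CONDITIONAL on the named fact `skodaBrownawellDegreeBound` (hypothesis `hS`) and on
`GCTMult.GctThesis` (item stmt-ValiantsHypothesis-0323, hypothesis `hG`). -/
theorem certWindowQP_hasHermitianSos_of_skodaBrownawell
    (hS : ∀ {σ ι : Type} [Fintype σ], skodaBrownawellDegreeBound (σ := σ) (ι := ι))
    (hG : GCTMult.GctThesis) (c : ℕ) :
    ∃ n : ℕ, ∀ m ≤ 2 ^ ((Nat.log 2 n + c) ^ c),
      HasHermitianSosRefutationOfDegree (fun μ : (Fin n × Fin n) →₀ ℕ => ((Matrix.of fun i j : Fin m => MvPolynomial.C (MvPolynomial.X (none, (i, j))) + ∑ e : Fin n × Fin n, MvPolynomial.X e * MvPolynomial.C (MvPolynomial.X (some e, (i, j))) : Matrix (Fin m) (Fin m) (MvPolynomial (Fin n × Fin n) (MvPolynomial (Option (Fin n × Fin n) × (Fin m × Fin m)) ℂ))).det - MvPolynomial.map MvPolynomial.C (Literature.Computability.AlgebraicComplexity.perPoly (Fin n) ℂ)).coeff μ) ((m + 2) ^ 5) := by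
  classical
  obtain ⟨n₀, hn₀⟩ := hG c
  obtain ⟨n, hn₀n, h1n⟩ : ∃ n : ℕ, n₀ ≤ n ∧ 1 ≤ n := ⟨max n₀ 1, le_max_left _ _, le_max_right _ _⟩
  refine ⟨n, fun m hm => ?_⟩
  by_cases hlt : m < n
  · exact ((stub_nsSmall n m hlt).mono (Nat.zero_le _)).hasHermitianSosRefutationOfDegree
  · push Not at hlt
    haveI : NeZero m := ⟨by omega⟩
    have hpad := hn₀ n hn₀n m hlt hm
    obtain ⟨ε, hε, hloj⟩ := stub_lojZero n m hlt hpad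
    have hns := hS (σ := Option (Fin n × Fin n) × (Fin m × Fin m))
      (ι := (Fin n × Fin n) →₀ ℕ) _ (fun μ : (Fin n × Fin n) →₀ ℕ => ((Matrix.of fun i j : Fin m => MvPolynomial.C (MvPolynomial.X (none, (i, j))) + ∑ e : Fin n × Fin n, MvPolynomial.X e * MvPolynomial.C (MvPolynomial.X (some e, (i, j))) : Matrix (Fin m) (Fin m) (MvPolynomial (Fin n × Fin n) (MvPolynomial (Option (Fin n × Fin n) × (Fin m × Fin m)) ℂ))).det - MvPolynomial.map MvPolynomial.C (Literature.Computability.AlgebraicComplexity.perPoly (Fin n) ℂ)).coeff μ)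
      m 0 (fun μ _ => stub_coeffDegree n m μ) ⟨ε, hε, fun a => by simpa using hloj a⟩
    exact (hns.mono (by simpa using stub_degArith n m hlt)).hasHermitianSosRefutationOfDegree

/-- **Line `Sketch` / `skoda-border-sandwich` (crux stmt-ValiantsHypothesis-5640), closing
composition: `GctThesis ⇒ CertWindowQP` modulo the Skoda–Brownawell degree bound**, with `c' = 5`:
`certWindowQP_hasHermitianSos_of_skodaBrownawell` rewritten in the route's inlined Hermitian-SOS form by
`exists_sos_certificate_support_of_hasHermitianSosRefutationOfDegree_coeff` (the content of `stub_sosRoute`). CONDITIONAL on the named fact `skodaBrownawellDegreeBound` (hypothesis `hS`,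
Literature debt: Skoda 1972 Thm 1 + Liouville) and on `GCTMult.GctThesis` (item
stmt-ValiantsHypothesis-0323, hypothesis `hG`); the crux is thereby closed MODULO these two inputs. -/
theorem CertWindowQP_of_skodaBrownawell
    (hS : ∀ {σ ι : Type} [Fintype σ], skodaBrownawellDegreeBound (σ := σ) (ι := ι))
    (hG : GCTMult.GctThesis) : RefutationDegree.CertWindowQP := by
  refine ⟨5, fun c => ?_⟩
  obtain ⟨n, hn⟩ := certWindowQP_hasHermitianSos_of_skodaBrownawell hS hG c
  exact ⟨n, fun m hm =>
    exists_sos_certificate_support_of_hasHermitianSosRefutationOfDegree_coeff _ ((m + 2) ^ 5) (hn m hm)⟩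

end Summit.ValiantsHypothesis.ValiantsHypothesis.Theorems
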